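import Summits.Parity.GeneralizedHardyLittlewood.Theorems.LiouvilleShiftedTablesSieveToMAvgDispatchII

/-!
# Sieve glue for `SieveToMAvg`, part 8b: dispatching a non-Type-II box tuple to the Type-I₂ bound

Support file for item stmt-Parity-14274 (route `LiouvilleShiftedTables`).  A box tuple `κ` of a
log-free Heath-Brown piece with a designated big SMOOTH slot `p` (and possibly a second one `σ`) is
a triple product `γ ⋆ 𝟙_{(s₁,s₂]} ⋆ 𝟙_{(n₁,n₂]}`: the boxed smooth factors are interval indicators
(`bFactor_eq_indAF`), `γ` is the product of the remaining slots (supported on `r ≤ 2^{#rest} ∏ P_i`,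
`|γ| ≤ τ^{#rest}`), and in the one-big-slot case the `s`-factor is the Dirichlet unit `𝟙_{(0,1]}`.
Part 7f then bounds `TT(prodB κ)`; here the divisor power sums `Dτ`, `Dτ'` replace the norms of `γ`.
-/

namespace Summit.Parity.GeneralizedHardyLittlewood.Theorems.SieveToMAvg

open Finset Real
open scoped ArithmeticFunction.zeta ArithmeticFunction.sigma
open Literature.NumberTheory.Sieve (abs_prod_apply_le_sigma_zero_pow one_le_sigma_zero)
open Literature.NumberTheory.Sieve.BFI

/-- Logarithmic divisor power sums `Dτ'(r, y) = ∑_{n ≤ y} τ(n)^r / n`. [folklore] -/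
noncomputable def Dtau' (r : ℕ) (y : ℝ) : ℝ := ∑ n ∈ Icc 1 ⌊y⌋₊, (σ 0 n : ℝ) ^ r / n

/-- `Dτ' ≥ 0`. [folklore] -/
theorem Dtau'_nonneg (r : ℕ) (y : ℝ) : 0 ≤ Dtau' r y := Finset.sum_nonneg fun _ _ => by positivity

section DispatchI2

variable {x : ℝ} {U j t : ℕ}

/-- `indAF 0 1` is the Dirichlet unit. [folklore] -/
theorem indAF_zero_one : indAF 0 1 = (1 : ArithmeticFunction ℝ) := by
  ext n
  rw [indAF_apply, ArithmeticFunction.one_apply]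
  by_cases h1 : n = 1
  · subst h1; simp
  · rw [if_neg, if_neg h1]
    rintro ⟨h0, -, h2⟩
    have : (n : ℝ) ≤ 1 := h2
    have hn : n ≤ 1 := by exact_mod_cast this
    omega

/-- The cut of a smooth slot: `t' = t` in the last slot, `0` otherwise. [folklore] -/
def tCut (j t i : ℕ) : ℕ := if i < 2 * j - 1 then 0 else t

/-- **A boxed smooth factor is an interval indicator**: for `j ≤ i`, `x > 0`,
`bFactor i k = indAF (min (max P_k t') (2P_k)) (2P_k)`. [folklore] -/
theorem bFactor_eq_indAF (hx : 0 < x) {i : ℕ} (hi : j ≤ i) (k : ℕ) :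
    bFactor x U j t i k = indAF (min (max (P x k) (tCut j t i)) (2 * P x k)) (2 * P x k) := by
  ext n
  rw [bFactor_apply_of_le hi, indAF_apply]
  have hP := P_pos hx k
  unfold tCut
  by_cases hc : (P x k < n ∧ (n : ℝ) ≤ 2 * P x k) ∧ ((if i < 2 * j - 1 then 0 else t) : ℕ) < n
  · rw [if_pos hc, if_pos]
    obtain ⟨⟨h1, h2⟩, h3⟩ := hc
    have hn0 : (0 : ℝ) < n := hP.trans h1
    refine ⟨by exact_mod_cast hn0, lt_of_le_of_lt (min_le_left _ _) (max_lt h1 (by exact_mod_cast h3)), h2⟩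
  · rw [if_neg hc, if_neg]
    rintro ⟨h0, h1, h2⟩
    apply hc
    have hmax : max (P x k) ((if i < 2 * j - 1 then 0 else t : ℕ) : ℝ) < n := by
      rcases le_total (max (P x k) ((if i < 2 * j - 1 then 0 else t : ℕ) : ℝ)) (2 * P x k) with hle | hle
      · rwa [min_eq_left hle] at h1
      · rw [min_eq_right hle] at h1; linarith
    exact ⟨⟨lt_of_le_of_lt (le_max_left _ _) hmax, h2⟩, by exact_mod_cast lt_of_le_of_lt (le_max_right _ _) hmax⟩

/-- `0 ≤ n₁ ≤ n₂` for the ends of a smooth factor. [folklore] -/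
theorem indAF_ends_ok (hx : 0 < x) (i k : ℕ) :
    0 ≤ min (max (P x k) (tCut j t i)) (2 * P x k) ∧ min (max (P x k) (tCut j t i)) (2 * P x k) ≤ 2 * P x k :=
  ⟨le_min (le_max_of_le_left (P_pos hx k).le) (by linarith [P_pos hx k]), min_le_right _ _⟩

/-- Norms of a sub-product through divisor power sums: for `T` nonempty with `2^{#T} ∏_T P ≤ Y` and
`Y ≤ 2x`: `∑_{r≤2x} |γ(r)| ≤ Dτ(2j, Y)`, `∑ γ(r)² ≤ Dτ(4j, Y)`, `∑ γ(r)²/r ≤ Dτ'(4j, 2x)`. [folklore] -/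
theorem subprod_norms_le (hx : 0 < x) (κ : Fin (2 * j) → ℕ) {T : Finset (Fin (2 * j))} (hT : T.Nonempty)
    {Y : ℝ} (hY : 2 ^ T.card * ∏ i ∈ T, P x (κ i) ≤ Y) :
    (∑ r ∈ Ioc 0 ⌊2 * x⌋₊, |(∏ i ∈ T, bFactor x U j t i (κ i)) r| ≤ Dtau (2 * j) Y) ∧
    (∑ r ∈ Ioc 0 ⌊2 * x⌋₊, ((∏ i ∈ T, bFactor x U j t i (κ i)) r) ^ 2 ≤ Dtau (4 * j) Y) ∧
    (∑ r ∈ Ioc 0 ⌊2 * x⌋₊, ((∏ i ∈ T, bFactor x U j t i (κ i)) r) ^ 2 / r ≤ Dtau' (4 * j) (2 * x)) := by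
  classical
  set γ := ∏ i ∈ T, bFactor x U j t i (κ i) with hγ
  have hcard : T.card ≤ 2 * j := by
    have := Finset.card_le_univ T; rwa [Fintype.card_fin] at this
  have habs : ∀ r : ℕ, 1 ≤ r → |γ r| ≤ (σ 0 r : ℝ) ^ (2 * j) := by
    intro r hr
    have hτ : (1 : ℝ) ≤ (σ 0 r : ℝ) := by exact_mod_cast one_le_sigma_zero (by omega : r ≠ 0)
    exact (abs_subprod_le κ T r).trans (pow_le_pow_right₀ hτ hcard)
  have hsq : ∀ r : ℕ, 1 ≤ r → (γ r) ^ 2 ≤ (σ 0 r : ℝ) ^ (4 * j) := by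
    intro r hr
    calc (γ r) ^ 2 = |γ r| ^ 2 := (sq_abs _).symm
      _ ≤ ((σ 0 r : ℝ) ^ (2 * j)) ^ 2 := pow_le_pow_left₀ (abs_nonneg _) (habs r hr) 2
      _ = (σ 0 r : ℝ) ^ (4 * j) := by rw [← pow_mul]; ring_nf
  have hsupp : ∀ r : ℕ, γ r ≠ 0 → r ∈ Icc 1 ⌊Y⌋₊ := by
    intro r hr
    obtain ⟨h1, h2⟩ := subprod_ne_zero hx κ hT hr
    have hpos : 0 < ∏ i ∈ T, P x (κ i) := Finset.prod_pos fun i _ => P_pos hx (κ i)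
    rw [Finset.mem_Icc]
    refine ⟨?_, Nat.le_floor (h2.trans hY)⟩
    have : (0 : ℝ) < r := hpos.trans h1
    exact_mod_cast this
  -- generic restriction-to-support step
  have hres : ∀ (F : ℕ → ℝ), (∀ r, 0 ≤ F r) → (∀ r, γ r = 0 → F r = 0) →
      ∑ r ∈ Ioc 0 ⌊2 * x⌋₊, F r ≤ ∑ r ∈ Icc 1 ⌊Y⌋₊, F r := by
    intro F hF0 hFz
    calc ∑ r ∈ Ioc 0 ⌊2 * x⌋₊, F r = ∑ r ∈ (Ioc 0 ⌊2 * x⌋₊).filter (fun r => γ r ≠ 0), F r := by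
          rw [Finset.sum_filter]
          refine Finset.sum_congr rfl fun r _ => ?_
          split_ifs with h0
          · rfl
          · push Not at h0; exact hFz r h0
      _ ≤ ∑ r ∈ Icc 1 ⌊Y⌋₊, F r :=
          Finset.sum_le_sum_of_subset_of_nonneg (fun r hr => hsupp r (Finset.mem_filter.1 hr).2) fun r _ _ => hF0 r
  refine ⟨?_, ?_, ?_⟩
  · refine (hres (fun r => |γ r|) (fun r => abs_nonneg _) (fun r h0 => by simp [h0])).trans ?_
    exact Finset.sum_le_sum fun r hr => habs r (Finset.mem_Icc.1 hr).1
  · refine (hres (fun r => (γ r) ^ 2) (fun r => sq_nonneg _) (fun r h0 => by simp [h0])).trans ?_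
    exact Finset.sum_le_sum fun r hr => hsq r (Finset.mem_Icc.1 hr).1
  · unfold Dtau'
    have h1 : Icc 1 ⌊2 * x⌋₊ = Ioc 0 ⌊2 * x⌋₊ := rfl
    rw [h1]
    refine Finset.sum_le_sum fun r hr => ?_
    have hr1 : 1 ≤ r := (Finset.mem_Ioc.1 hr).1
    exact div_le_div_of_nonneg_right (hsq r hr1) (Nat.cast_nonneg r)

variable {h Q : ℕ} {X Δ ρ' A C₂ : ℝ}

/-- **The Type-I₂ bound for a tuple with a triple-product decomposition.**  If
`prodB κ = (∏_{i∈T} bFactor) ⋆ indAF s₁ s₂ ⋆ indAF n₁ n₂` with `T ≠ ∅`, `R = 2^{#T} ∏_T P_i`,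
`1 ≤ R ≤ X^ρ'`, `R ≤ 2x`, `0 < s₂ ≤ 2x`, `s₂ R ≤ X^{1/2+ρ'}`, `0 ≤ n₁ ≤ n₂`, `2x < (1+Δ)^K`,
`Q ≤ ⌊X^ρ'⌋`, then under `HypI2`:
`TT(prodB κ) ≤ 4K√K √(2x H_Q H_{2x} Dτ'(4j,2x) + s₂ Q Dτ(4j,R)) √(C₂X/(log X)^A) + Dτ(2j,R) s₂ ((((1+Δ)²−1)(n₁+n₂)+2)H_Q + 2Q)`.
[folklore] -/
theorem TT_prodB_le_I2 (hyp : HypI2 X (-(h : ℤ)) h ρ' A C₂) (hx : 0 < x) (hxX : 2 * x ≤ X) (hΔ : 0 < Δ)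
    {K : ℕ} (hK : 2 * x < (1 + Δ) ^ K) (hQ : Q ≤ ⌊X ^ ρ'⌋₊)
    (κ : Fin (2 * j) → ℕ) {T : Finset (Fin (2 * j))} (hT : T.Nonempty) {s₁ s₂ n₁ n₂ : ℝ}
    (hdecomp : prodB x U j t κ = (∏ i ∈ T, bFactor x U j t i (κ i)) * indAF s₁ s₂ * indAF n₁ n₂)
    (hR1 : 1 ≤ 2 ^ T.card * ∏ i ∈ T, P x (κ i)) (hRX : 2 ^ T.card * ∏ i ∈ T, P x (κ i) ≤ X ^ ρ')
    (hRx : 2 ^ T.card * ∏ i ∈ T, P x (κ i) ≤ 2 * x) (hs₂ : 0 < s₂) (hs₂x : s₂ ≤ 2 * x)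
    (hsR : s₂ * (2 ^ T.card * ∏ i ∈ T, P x (κ i)) ≤ X ^ (1 / 2 + ρ')) (hn₁ : 0 ≤ n₁) (hn₁₂ : n₁ ≤ n₂) :
    TT (lamW h) h Q x (fun n => prodB x U j t κ n) ≤
      4 * K * Real.sqrt K *
        Real.sqrt (2 * x * Hsum Q * Hsum (2 * x) * Dtau' (4 * j) (2 * x) +
          s₂ * Q * Dtau (4 * j) (2 ^ T.card * ∏ i ∈ T, P x (κ i))) * Real.sqrt (C₂ * X / Real.log X ^ A) +
      Dtau (2 * j) (2 ^ T.card * ∏ i ∈ T, P x (κ i)) * s₂ * ((((1 + Δ) ^ 2 - 1) * (n₁ + n₂) + 2) * Hsum Q + 2 * Q) := by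
  set γ := ∏ i ∈ T, bFactor x U j t i (κ i) with hγ
  set R := 2 ^ T.card * ∏ i ∈ T, P x (κ i) with hRdef
  have hγsupp : ∀ r : ℕ, γ r ≠ 0 → (r : ℝ) ≤ R := fun r hr => (subprod_ne_zero hx κ hT hr).2
  have hKr : R < (1 + Δ) ^ K := lt_of_le_of_lt hRx hK
  have hKs : s₂ < (1 + Δ) ^ K := lt_of_le_of_lt hs₂x hK
  have hmain := TT_triple_le (γ := γ) (s₁ := s₁) hyp hx hxX hΔ hR1 hRX hRx hKr hγsupp hs₂ hs₂x hKs hsR hn₁ hn₁₂ hQ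
  have hfun : (fun n => prodB x U j t κ n) = fun n => (γ * indAF s₁ s₂ * indAF n₁ n₂) n := by
    ext n; rw [hdecomp]
  rw [hfun]
  refine hmain.trans ?_
  obtain ⟨hn1, hn2, hn3⟩ := subprod_norms_le (U := U) (t := t) hx κ hT (le_refl R)
  have hHQ := Hsum_nonneg (Q : ℝ)
  have hH2 := Hsum_nonneg (2 * x)
  have hHs : Hsum s₂ ≤ Hsum (2 * x) := Hsum_mono hs₂x
  have hΘ0 : 0 ≤ (((1 + Δ) ^ 2 - 1) * (n₁ + n₂) + 2) * Hsum Q + 2 * Q := by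
    have hD : 0 ≤ (1 + Δ) ^ 2 - 1 := by nlinarith
    have : 0 ≤ n₁ + n₂ := by linarith
    positivity
  have hD' := Dtau'_nonneg (4 * j) (2 * x)
  gcongr

/-- **One big slot** (`p` smooth, all other slots small): the decomposition
`prodB κ = (∏_{i ≠ p} bFactor) ⋆ indAF 0 1 ⋆ indAF n₁ n₂` with the ends of the `p`-th factor. [folklore] -/
theorem prodB_eq_triple_one (hx : 0 < x) (κ : Fin (2 * j) → ℕ) {p : Fin (2 * j)} (hp : j ≤ (p : ℕ)) :
    prodB x U j t κ = (∏ i ∈ Finset.univ.erase p, bFactor x U j t i (κ i)) * indAF 0 1 *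
      indAF (min (max (P x (κ p)) (tCut j t p)) (2 * P x (κ p))) (2 * P x (κ p)) := by
  rw [indAF_zero_one, mul_one, ← bFactor_eq_indAF (U := U) hx hp]
  unfold prodB
  exact (Finset.prod_erase_mul _ _ (Finset.mem_univ p)).symm

/-- **Two big slots** (`p ≠ σ` smooth): the decomposition
`prodB κ = (∏_{i ∉ {p,σ}} bFactor) ⋆ (σ-th factor as indAF) ⋆ (p-th factor as indAF)`. [folklore] -/
theorem prodB_eq_triple_two (hx : 0 < x) (κ : Fin (2 * j) → ℕ) {p σ' : Fin (2 * j)} (hp : j ≤ (p : ℕ))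
    (hσ : j ≤ (σ' : ℕ)) (hne : σ' ≠ p) :
    prodB x U j t κ = (∏ i ∈ (Finset.univ.erase p).erase σ', bFactor x U j t i (κ i)) *
      indAF (min (max (P x (κ σ')) (tCut j t σ')) (2 * P x (κ σ'))) (2 * P x (κ σ')) *
      indAF (min (max (P x (κ p)) (tCut j t p)) (2 * P x (κ p))) (2 * P x (κ p)) := by
  rw [← bFactor_eq_indAF (U := U) hx hp, ← bFactor_eq_indAF (U := U) hx hσ]
  unfold prodB
  have hσmem : σ' ∈ Finset.univ.erase p := Finset.mem_erase.2 ⟨hne, Finset.mem_univ _⟩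
  rw [← Finset.prod_erase_mul _ _ (Finset.mem_univ p), ← Finset.prod_erase_mul _ _ hσmem]

end DispatchI2

end Summit.Parity.GeneralizedHardyLittlewood.Theorems.SieveToMAvg
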